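import Summits.Ventures.PercRepro.ProfileGapMonoThresholdTopNuTwoCount

/-!
# PercRepro — THE TYPE TABLE: the two sides of `(I_t)` at co-rank `4` on a matroid with a plane of `ν + 2` points
are binomial sums of counts over the subsets of the plane, at EVERY threshold `t` (p5, gen 30;
`proofs/P5-GM1.md` §41(b), (f)(5); announced INBOX 13953)

For `F = cl B` a plane with `ν + 2` points on a coloop-free matroid of rank `R ≥ 4`, `O = E ∖ F` its series-class
complement (`s = #O`), every `X ⊆ E` is `Y ∪ D` (`Y ⊆ O`, `D ⊆ F`) and by the rank formulas of
ProfileGapMonoThresholdSeriesExtension both sides of `(I_t)` split by `k = #Y`: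
**`thresholdSum_eq_sum_choose_of_long_plane`** — `thresholdSum N 4 t = Σ_k C(s,k) · L(k)` with
`L(0) = Σ_{D spanning, ρ(O ∪ (F∖D)) ≥ t+1} ρ(O ∪ (F∖D))`,
`L(k) = Σ_{ρ(D) + k = 3, (s−k) + ρ(F∖D) ≥ t+1} ((s−k) + ρ(F∖D))` for `0 < k < s`, and
`L(s) = Σ_{ρ(O ∪ D) = 3, ρ(F∖D) ≥ t+1} ρ(F∖D)`; **`card_levelSetCoQ_eq_sum_choose_of_long_plane`** —
`#T_t = Σ_k C(s,k) · T(k)` with `T(0) = 0`, `T(k) = #{ρ(D) + k = 4, (s−k) + ρ(F∖D) ≥ t}` for `0 < k < s`, and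
`T(s) = #{ρ(O ∪ D) = 4, ρ(F∖D) ≥ t}`.  This is the table of §41(b) (census-exact on 1,762 instances) as a kernel
identity, for every `t`: the co-rank-`4` family on such a matroid is a statement about the rank function of `N` on the
subsets of the plane and the position of the series class.  Nothing open is asserted.
-/

open scoped Matroid

namespace PercRepro.Cogirth

open Finset ThmH Skew Shadow Profile

variable {α : Type} [DecidableEq α] {N : Matroid α} [N.Finite]

section TypeTable

/-- **THE THRESHOLD SUM AS A BINOMIAL SUM OVER THE PLANE**, every `t`. -/
theorem thresholdSum_eq_sum_choose_of_long_plane (hcf : ∀ z ∈ gr N, rk N ((gr N).erase z) = rk N (gr N))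
    {B : Finset α} (hB : B ∈ Rq N 3) (hlong : (clF N B).card + rk N (gr N) = (gr N).card + 2) (t : ℕ) :
    thresholdSum N 4 t =
      ∑ k ∈ range ((gr N \ clF N B).card + 1), (gr N \ clF N B).card.choose k *
        (if k = 0 then
          ∑ D ∈ (clF N B).powerset,
            (if rk N D = 3 ∧ t + 1 ≤ rk N ((gr N \ clF N B) ∪ (clF N B \ D)) then
              rk N ((gr N \ clF N B) ∪ (clF N B \ D)) else 0)
        else if k = (gr N \ clF N B).card then
          ∑ D ∈ (clF N B).powerset,
            (if rk N ((gr N \ clF N B) ∪ D) = 3 ∧ t + 1 ≤ rk N (clF N B \ D) then rk N (clF N B \ D) else 0)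
        else
          ∑ D ∈ (clF N B).powerset,
            (if rk N D + k = 3 ∧ t + 1 ≤ (gr N \ clF N B).card - k + rk N (clF N B \ D) then
              (gr N \ clF N B).card - k + rk N (clF N B \ D) else 0)) := by
  have hclg : clF N B ⊆ gr N := clF_subset_gr B
  have hpow : (gr N).powerset = ((gr N \ clF N B) ∪ clF N B).powerset := by
    rw [sdiff_union_of_subset hclg]
  have hOF : Disjoint (gr N \ clF N B) (clF N B) := sdiff_disjoint
  -- the threshold sum as a sum over all subsets of `E`
  have hsum : thresholdSum N 4 t =
      ∑ X ∈ ((gr N \ clF N B) ∪ clF N B).powerset,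
        (if N.eRk (X : Set α) = ((3 : ℕ) : ℕ∞) then
          (if t + 1 ≤ rk N (gr N \ X) then rk N (gr N \ X) else 0) else 0) := by
    unfold thresholdSum Rq
    rw [← hpow, sum_filter]
  rw [hsum, sum_powerset_union_of_disjoint hOF]
  apply sum_powerset_eq_sum_choose
  intro Y hY
  rw [mem_powerset] at hY
  by_cases hY0 : Y = ∅
  · subst hY0
    simp only [card_empty, if_true]
    apply sum_congr rfl
    intro D hD
    rw [mem_powerset] at hD
    rw [empty_union]
    by_cases h3 : rk N D = 3
    · rw [if_pos (eRk_eq_iff_rk_eq.2 h3), sdiff_eq_union_sdiff_of_subset_clF B hD]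
      simp only [h3, true_and]
    · rw [if_neg (fun h => h3 (eRk_eq_iff_rk_eq.1 h))]
      simp only [h3, false_and, if_false]
  by_cases hYO : Y = gr N \ clF N B
  · subst hYO
    have hk : (gr N \ clF N B).card ≠ 0 := by
      rw [Ne, card_eq_zero]; exact hY0
    simp only [hk, if_false, if_true]
    apply sum_congr rfl
    intro D hD
    rw [mem_powerset] at hD
    by_cases h3 : rk N ((gr N \ clF N B) ∪ D) = 3
    · rw [if_pos (eRk_eq_iff_rk_eq.2 h3), sdiff_union_sdiff_eq]
      simp only [h3, true_and]
    · rw [if_neg (fun h => h3 (eRk_eq_iff_rk_eq.1 h))]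
      simp only [h3, false_and, if_false]
  · have hYne : Y.Nonempty := nonempty_iff_ne_empty.2 hY0
    have hk0 : Y.card ≠ 0 := by rw [Ne, card_eq_zero]; exact hY0
    have hks : Y.card ≠ (gr N \ clF N B).card := by
      intro h
      exact hYO (eq_of_subset_of_card_le hY h.ge)
    simp only [hk0, hks, if_false]
    apply sum_congr rfl
    intro D hD
    rw [mem_powerset] at hD
    obtain ⟨h1, h2⟩ := rk_union_cases hcf hB hlong hY hD hYne hYO
    by_cases h3 : rk N D + Y.card = 3
    · rw [if_pos (eRk_eq_iff_rk_eq.2 (by rw [h1]; omega)), h2, card_sdiff_of_subset hY]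
      simp only [h3, true_and]
    · rw [if_neg (fun h => h3 (by have := eRk_eq_iff_rk_eq.1 h; rw [h1] at this; omega))]
      simp only [h3, false_and, if_false]

/-- **THE TARGET COUNT AS A BINOMIAL SUM OVER THE PLANE**, every `t`. -/
theorem card_levelSetCoQ_eq_sum_choose_of_long_plane (hcf : ∀ z ∈ gr N, rk N ((gr N).erase z) = rk N (gr N))
    {B : Finset α} (hB : B ∈ Rq N 3) (hlong : (clF N B).card + rk N (gr N) = (gr N).card + 2) (t : ℕ) :
    (levelSetCoQ N t 4).card =
      ∑ k ∈ range ((gr N \ clF N B).card + 1), (gr N \ clF N B).card.choose k *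
        (if k = 0 then 0
        else if k = (gr N \ clF N B).card then
          ((clF N B).powerset.filter
            (fun D => rk N ((gr N \ clF N B) ∪ D) = 4 ∧ t ≤ rk N (clF N B \ D))).card
        else
          ((clF N B).powerset.filter
            (fun D => rk N D + k = 4 ∧ t ≤ (gr N \ clF N B).card - k + rk N (clF N B \ D))).card) := by
  have hclg : clF N B ⊆ gr N := clF_subset_gr B
  have hpow : (gr N).powerset = ((gr N \ clF N B) ∪ clF N B).powerset := by
    rw [sdiff_union_of_subset hclg]
  have hOF : Disjoint (gr N \ clF N B) (clF N B) := sdiff_disjoint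
  have hT : levelSetCoQ N t 4 =
      ((gr N \ clF N B) ∪ clF N B).powerset.filter
        (fun (X : Finset α) => N.eRk (X : Set α) = ((4 : ℕ) : ℕ∞) ∧ t ≤ rk N (gr N \ X)) := by
    rw [← hpow]
    ext X
    rw [mem_levelSetCoQ, mem_filter, mem_powerset]
    tauto
  rw [hT, card_filter_powerset_union_of_disjoint hOF]
  apply sum_powerset_eq_sum_choose
  intro Y hY
  rw [mem_powerset] at hY
  by_cases hY0 : Y = ∅
  · subst hY0
    simp only [card_empty, if_true]
    rw [card_eq_zero, filter_eq_empty_iff]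
    intro D hD
    rw [mem_powerset] at hD
    rintro ⟨h1, _⟩
    rw [empty_union, eRk_eq_iff_rk_eq] at h1
    have := rk_le_three_of_subset_clF hB hD
    omega
  by_cases hYO : Y = gr N \ clF N B
  · subst hYO
    have hk : (gr N \ clF N B).card ≠ 0 := by
      rw [Ne, card_eq_zero]; exact hY0
    simp only [hk, if_false, if_true]
    apply congrArg
    apply filter_congr
    intro D hD
    rw [mem_powerset] at hD
    rw [eRk_eq_iff_rk_eq, sdiff_union_sdiff_eq]
  · have hYne : Y.Nonempty := nonempty_iff_ne_empty.2 hY0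
    have hk0 : Y.card ≠ 0 := by rw [Ne, card_eq_zero]; exact hY0
    have hks : Y.card ≠ (gr N \ clF N B).card := by
      intro h
      exact hYO (eq_of_subset_of_card_le hY h.ge)
    simp only [hk0, hks, if_false]
    apply congrArg
    apply filter_congr
    intro D hD
    rw [mem_powerset] at hD
    obtain ⟨h1, h2⟩ := rk_union_cases hcf hB hlong hY hD hYne hYO
    rw [eRk_eq_iff_rk_eq, h1, h2, card_sdiff_of_subset hY, add_comm Y.card (rk N D)]

end TypeTable

end PercRepro.Cogirth
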